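import Summits.QuantumFields.YangMills.Theses.BalabanUVNodes
import Summits.QuantumFields.YangMills.Theorems.BalabanUVNodesN27AtBothPinsOfRecord13CoPHVCut

/-!
# BalabanUVNodes ∕ N27 = binder B5 AT THE RECORD, leaf — K3⁷ `Theses.BalabanUVNodes.SpineGivenEndpointR13SepCoPH` **WITH BOTH v3 PINS AND NOTHING PARAMETRIC LEFT BUT THE NODES' IN-EDGES**:
# the RATE reading pinned to node00-def-W1's KERNEL OBJECTS OF RECORD (`hpin` = v3's `U3PinnedKernels 𝔯 ℓ`; dag-n27-w1 (K) p594329) on the WHOLE guard, the SPINE reading pinned at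
# dag-n20-d's physical-volume reading of record WITH THE CUT READ PER TUPLE (`fun F θ hP g₀ os ↦ crOfRecord₁₃VAt K₀ (jc F θ hP g₀ os) sh F θ hP g₀ os` = v3's `PinnedAtLive jc sh cr`
# witness at `K₀ = 0`) ON THE LIVE-SELECTOR LINE and a free reading `cr'` off it — the v3 successor of IV `…SepCoPHBothReadingsOfRecordV` (p592532)
# (cell `pub-ymgap`, HUMAN RULING D-0062 Track A, R134 seat `pub-ymgap-dag-n27-c` (N27 B5 composite, s2) gen 12, HOME trigger (t3) plan g81 K3⁷ skeleton v3 02f6f498332fdbee;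
# `--kind proof --supports stmt-QuantumFields-20544 --as helper`; COUNT-NEUTRAL; ONE theorem, 0 `def`, 0 `sorry`; a route-facing leaf, nothing may import it)

WHAT THIS LEAF DISPLAYS (`N = 2`, guard `θ.ZhUnity F 2 ∧ θ.SlotsNondegenerate₁₃ F 2`, `hc := hP.toCore`).  THE ITEM from, binder by binder: the pin `hpin`; N14 ∕ N15 ∕ N16-at-β as
SENTENCES at dag-n22-e's guard-of-record home `RRec₁₃CoPHOn 𝔯 (guard)` (restricted to each part by `rRec₁₃CoPHOn_mono`); N18 ∕ N22 on the kernel bundles `(rateCarriersOfRecord₁₃CoPH 𝔯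
F θ hP g₀ os k).u3` of every run length (dag-n18-w1's ∕ dag-n22-w3's conclusion shapes); (D4)'s four kernel inputs per guarded tuple — `(ℓ F θ).Signs`, `0 < κ`, `betaPrime510 4 1 κ ≤
cr`, print's (5.10) clause `KernelDecayOfRecord₁₃ F 2 θ 0 1 κ` (dag-n27-w1 g0 `readOutAt_objectsOfRecord₁₃_coPH`); N17 ELIMINATED (dag-n17-a); ON THE LIVE LINE the one law `hζm`
((H-U), `0 ≤ ζ` supplied by K0c ∕ n20-w2's theorems in BP; ⇒ N27x, UC §0), keyed N20 ∕ N21 witnesses at the spine reading's carriers with the tuple's own cut depth (`h20 h21`), the N19′ edge reading `∀ k, RatesHolderAt … β` to a summable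
`NE7.Core 1 (F.side ^ 4)` witness (`h19`); OFF THE LIVE LINE (K) at `cr'` — keyed N20 ∕ N21 (`h20' h21'`), `hx'`, `h19'`.  Storey BP §2 `spine_rec13CCoPHOn_live_of_kernels_pin_at_crOfRecord₁₃VAt_cut`
on `guard ∧ LiveSel`, (K) `spine_rec13CCoPHOn_holder_of_kernels_pin_bundled` at `cr'` on `guard ∧ ¬LiveSel`, U `spine_rec13CCoPHOn_of_split`, XXXVIᶜᵒᵖᴴ `spine_rec13CCoPHOn_iff_forall_guarded`.
★★★ `spineGivenEndpointR13SepCoPH_atBothPinsOfRecord₁₃CoPHV_cut_kernels_pinnedAtLive`.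

HONEST FRAMING.  NOT a discharge: a term of the item's type under displayed hypotheses (audit `proof.conditional`), every one inhabited for no family today (K0⁷
`Record13SepCoPHInhabited` OPEN); a REDUCTION at (D4): (5.10) for the limiting (1.21) kernels of the merged term of record is print's claim, NOT proved anywhere in the tree at these
objects; NE1′ ∕ NE2 ∕ NE3-at-β ∕ NE5 ∕ NE9 ∕ NE7 ∕ NE7b ∕ NE7c NOT PRINTED as used here for d = 4 and NOT PROVED at Bałaban's objects; `jc sh ℓ 𝔯 β cr'` FREE; no reading minted;
nothing of Bałaban's asserted or instantiated; N27 COMPOSITE, NOT discharged; K3⁷ NOT claimed closed; route rev 25 and skeleton v3 UNTOUCHED (composition = leaf D); counts UNMOVED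
(typed 28∕28 · discharged 5∕27, A 5∕28); one finite four-torus programme at fixed `ε` — NOT ℝ⁴, NOT infinite volume, NOT OS, NOT a mass gap, NOT Clay.  No decl below carries a cite tag.
-/

set_option autoImplicit false

namespace Summit.QuantumFields.YangMills.Theorems.BalabanUVNodesN27SpineRecord

open scoped BigOperators
open Literature.MathematicalPhysics.QuantumFieldTheory.Balaban1983to89
open Literature.MathematicalPhysics.QuantumFieldTheory.Balaban1983to89.T4Continuum
open Literature.MathematicalPhysics.QuantumFieldTheory.Balaban1983to89.Node00
open Literature.MathematicalPhysics.QuantumFieldTheory.Balaban1983to89.B12Sec2to5 (betaPrime510)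
open Literature.MathematicalPhysics.QuantumFieldTheory.Balaban1983to89.Node00.U3OfKernels (objectsOfRecord₁₃ KernelDecayOfRecord₁₃)
open T4WeightBudget (RelWeightBound)
open T4IndicatorShell (ShellWeightBound)
open T4ContinuumYM4Torus (ForSmallCouplings)
open Summit.QuantumFields.BalabanUV.T4Continuum.Spine
open Summit.QuantumFields.YangMills.Theses.BalabanUVNodes (SpineGivenEndpointR13SepCoPH)
open YMDAG.UVSplit
open Summit.QuantumFields.YangMills.BalabanUVNodes.N19TargetClassWeightsE1Keyed
open Summit.QuantumFields.YangMills.BalabanUVNodes.N16HolderDefs (S_N16Holder)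
open Summit.QuantumFields.YangMills.BalabanUVNodes.SpineRatesHolder (RatesHolderAt)

variable (K₀ : ℕ) (jc : (F : T4Family) → (θ : Stage13HParams F 2) → θ.Provisos₁₃CoPH F 2 → (ℕ → ℝ) → List (ULoop F) → ℕ → ℕ)
  (sh : ShellSplit₁₃CoPH 2 K₀)
  (cr' : (F : T4Family) → (θ : Stage13HParams F 2) → θ.Provisos₁₃CoPH F 2 → (ℕ → ℝ) → List (ULoop F) → SpineCarriers)
  (β : ℝ) (𝔯 : RateReading₁₃CoPH 2) (ℓ : (F : T4Family) → Stage13HParams F 2 → U3Letters₁₁)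

/-- ★★★ **K3⁷ WITH BOTH v3 PINS — K4 AT THE KERNEL-PINNED RATE READING ON THE WHOLE GUARD, K5 AT THE PER-TUPLE-CUT PHYSICAL-VOLUME SPINE READING OF RECORD ON THE LIVE LINE, (K)
AT `cr'` OFF IT** (storey BP §2 on `guard ∧ LiveSel`; (K) `spine_rec13CCoPHOn_holder_of_kernels_pin_bundled` at `cr'` on `guard ∧ ¬LiveSel`; U `spine_rec13CCoPHOn_of_split`;
`hc := hP.toCore`).  Displayed = the nodes' in-edges at the two readings of record + the one law `hζm`; N17 eliminated; N27x a theorem on the live line.  NOT a discharge: a term of the item's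
type under displayed hypotheses, each inhabited for no family today; (5.10) and every NE-estimate NOT proved. [bookkeeping] -/
theorem spineGivenEndpointR13SepCoPH_atBothPinsOfRecord₁₃CoPHV_cut_kernels_pinnedAtLive
    (hpin : ∀ (F : T4Family) (θ : Stage13HParams F 2) (hP : θ.Provisos₁₃CoPH F 2) (g₀ : ℕ → ℝ) (os : List (ULoop F)),
      (𝔯.lit F θ hP g₀ os).u3 = objectsOfRecord₁₃ F 2 θ.toStage13Params (ℓ F θ))
    (h14 : S_N14 (RRec₁₃CoPHOn 𝔯 (fun F θ => θ.ZhUnity F 2 ∧ θ.SlotsNondegenerate₁₃ F 2))) (h15 : S_N15 (RRec₁₃CoPHOn 𝔯 (fun F θ => θ.ZhUnity F 2 ∧ θ.SlotsNondegenerate₁₃ F 2)))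
    (h16 : S_N16Holder β (RRec₁₃CoPHOn 𝔯 (fun F θ => θ.ZhUnity F 2 ∧ θ.SlotsNondegenerate₁₃ F 2)))
    (h18 : ∀ (F : T4Family) (θ : Stage13HParams F 2) (hP : θ.Provisos₁₃CoPH F 2), (θ.ZhUnity F 2 ∧ θ.SlotsNondegenerate₁₃ F 2) → θ.Admissible F 2 → ∀ (g₀ : ℕ → ℝ) (os : List (ULoop F)) (k : ℕ),
      N18At (rateCarriersOfRecord₁₃CoPH 𝔯 F θ hP g₀ os k).u3)
    (h22 : ∀ (F : T4Family) (θ : Stage13HParams F 2) (hP : θ.Provisos₁₃CoPH F 2), (θ.ZhUnity F 2 ∧ θ.SlotsNondegenerate₁₃ F 2) → θ.Admissible F 2 → ∀ (g₀ : ℕ → ℝ) (os : List (ULoop F)) (k : ℕ),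
      N22At (rateCarriersOfRecord₁₃CoPH 𝔯 F θ hP g₀ os k).u3)
    (hs : ∀ (F : T4Family) (θ : Stage13HParams F 2), θ.Provisos₁₃CoPH F 2 → (θ.ZhUnity F 2 ∧ θ.SlotsNondegenerate₁₃ F 2) → θ.Admissible F 2 → (ℓ F θ).Signs)
    (hκ : ∀ (F : T4Family) (θ : Stage13HParams F 2), θ.Provisos₁₃CoPH F 2 → (θ.ZhUnity F 2 ∧ θ.SlotsNondegenerate₁₃ F 2) → θ.Admissible F 2 → 0 < (ℓ F θ).κ)
    (hcr : ∀ (F : T4Family) (θ : Stage13HParams F 2), θ.Provisos₁₃CoPH F 2 → (θ.ZhUnity F 2 ∧ θ.SlotsNondegenerate₁₃ F 2) → θ.Admissible F 2 → betaPrime510 4 1 (ℓ F θ).κ ≤ (ℓ F θ).cr)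
    (hdec : ∀ (F : T4Family) (θ : Stage13HParams F 2), θ.Provisos₁₃CoPH F 2 → (θ.ZhUnity F 2 ∧ θ.SlotsNondegenerate₁₃ F 2) → θ.Admissible F 2 → KernelDecayOfRecord₁₃ F 2 θ.toStage13Params 0 1 (ℓ F θ).κ)
    (hζm : ∀ (F : T4Family) (θ : Stage13HParams F 2), θ.Provisos₁₃CoPH F 2 → ((θ.ZhUnity F 2 ∧ θ.SlotsNondegenerate₁₃ F 2) ∧ θ.ppSel = ppSelLiveOfRecord F 2 θ.ν θ.τ9 (EOfRecord₁₃ F 2 θ.toStage13Params) (wOfRecord₉ F 2 θ.toStage9Params)) → θ.Admissible F 2 → ZetaMeasurable F 2 θ.ζ)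
    (h20 : ∀ (F : T4Family) (θ : Stage13HParams F 2) (hP : θ.Provisos₁₃CoPH F 2), ((θ.ZhUnity F 2 ∧ θ.SlotsNondegenerate₁₃ F 2) ∧ θ.ppSel = ppSelLiveOfRecord F 2 θ.ν θ.τ9 (EOfRecord₁₃ F 2 θ.toStage13Params) (wOfRecord₉ F 2 θ.toStage9Params)) → θ.Admissible F 2 → ∀ (g₀ : ℕ → ℝ) (os : List (ULoop F)),
      ∃ W : ℕ → ℝ, RelWeightBound 1 (classSet₁₃ θ K₀ g₀) (weightA₁₃ θ hP K₀ g₀ os) (weightB₁₃ θ hP K₀ g₀ os) (badClass₁₃ θ K₀ g₀ (jc F θ hP g₀ os)) W)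
    (h21 : ∀ (F : T4Family) (θ : Stage13HParams F 2) (hP : θ.Provisos₁₃CoPH F 2), ((θ.ZhUnity F 2 ∧ θ.SlotsNondegenerate₁₃ F 2) ∧ θ.ppSel = ppSelLiveOfRecord F 2 θ.ν θ.τ9 (EOfRecord₁₃ F 2 θ.toStage13Params) (wOfRecord₉ F 2 θ.toStage9Params)) → θ.Admissible F 2 → ∀ (g₀ : ℕ → ℝ) (os : List (ULoop F)),
      ∃ Wsh : ℕ → ℝ, ShellWeightBound 1 (classSet₁₃ θ K₀ g₀) (weightA₁₃ θ hP K₀ g₀ os) (weightB₁₃ θ hP K₀ g₀ os) (sh F θ hP g₀ os).1 (sh F θ hP g₀ os).2 Wsh)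
    (h19 : ∀ (F : T4Family) (θ : Stage13HParams F 2) (hP : θ.Provisos₁₃CoPH F 2), ((θ.ZhUnity F 2 ∧ θ.SlotsNondegenerate₁₃ F 2) ∧ θ.ppSel = ppSelLiveOfRecord F 2 θ.ν θ.τ9 (EOfRecord₁₃ F 2 θ.toStage13Params) (wOfRecord₉ F 2 θ.toStage9Params)) → θ.Admissible F 2 → ∀ (g₀ : ℕ → ℝ) (os : List (ULoop F)),
      (∀ k : ℕ, RatesHolderAt (datumOfRecord₁₃CoPH F 2 θ hP) (rateCarriersOfRecord₁₃CoPH 𝔯 F θ hP g₀ os k) β) → letI : DecidableEq (Σ K, SiteSeqKey F (K₀ + K)) := Classical.decEq _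
        ∃ δ : ℕ → ℝ, NE7.Core 1 (F.side ^ 4) (classSet₁₃ θ K₀ g₀) (badClass₁₃ θ K₀ g₀ (jc F θ hP g₀ os)) (fun K t x => weightA₁₃ θ hP K₀ g₀ os K t x - (sh F θ hP g₀ os).1 K t x)
          (fun K t x => weightB₁₃ θ hP K₀ g₀ os K t x - (sh F θ hP g₀ os).2 K t x) δ ∧ Summable δ)
    (h20' : ∀ (F : T4Family) (θ : Stage13HParams F 2) (hP : θ.Provisos₁₃CoPH F 2), ((θ.ZhUnity F 2 ∧ θ.SlotsNondegenerate₁₃ F 2) ∧ ¬ θ.ppSel = ppSelLiveOfRecord F 2 θ.ν θ.τ9 (EOfRecord₁₃ F 2 θ.toStage13Params) (wOfRecord₉ F 2 θ.toStage9Params)) → θ.Admissible F 2 → ∀ (g₀ : ℕ → ℝ) (os : List (ULoop F)),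
      RelWeightBound (cr' F θ hP g₀ os).l₀ (cr' F θ hP g₀ os).T (cr' F θ hP g₀ os).A (cr' F θ hP g₀ os).B (cr' F θ hP g₀ os).Bad (cr' F θ hP g₀ os).W)
    (h21' : ∀ (F : T4Family) (θ : Stage13HParams F 2) (hP : θ.Provisos₁₃CoPH F 2), ((θ.ZhUnity F 2 ∧ θ.SlotsNondegenerate₁₃ F 2) ∧ ¬ θ.ppSel = ppSelLiveOfRecord F 2 θ.ν θ.τ9 (EOfRecord₁₃ F 2 θ.toStage13Params) (wOfRecord₉ F 2 θ.toStage9Params)) → θ.Admissible F 2 → ∀ (g₀ : ℕ → ℝ) (os : List (ULoop F)),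
      ShellWeightBound (cr' F θ hP g₀ os).l₀ (cr' F θ hP g₀ os).T (cr' F θ hP g₀ os).A (cr' F θ hP g₀ os).B (cr' F θ hP g₀ os).shA (cr' F θ hP g₀ os).shB
        (cr' F θ hP g₀ os).Wsh)
    (hx' : ∀ (F : T4Family) (θ : Stage13HParams F 2) (hP : θ.Provisos₁₃CoPH F 2), ((θ.ZhUnity F 2 ∧ θ.SlotsNondegenerate₁₃ F 2) ∧ ¬ θ.ppSel = ppSelLiveOfRecord F 2 θ.ν θ.τ9 (EOfRecord₁₃ F 2 θ.toStage13Params) (wOfRecord₉ F 2 θ.toStage9Params)) → θ.Admissible F 2 →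
      B16.EndStatementBPrinted (datumOfRecord₁₃CoPH F 2 θ hP).C → DagBinding.EndpointExistence (datumOfRecord₁₃CoPH F 2 θ hP).C.toB12 →
        ForSmallCouplings (datumOfRecord₁₃CoPH F 2 θ hP) fun g₀ => ∀ os : List (ULoop F),
          0 < (cr' F θ hP g₀ os).l₀ ∧ 0 < (cr' F θ hP g₀ os).vol ∧
          (∀ (K : ℕ) (t : ℝ), |t| ≤ (cr' F θ hP g₀ os).l₀ →
            T4GenFunBounds.schemeZ ((datumOfRecord₁₃CoPH F 2 θ hP).scheme g₀) os ((cr' F θ hP g₀ os).K₀ + K) t =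
              ∑ τ ∈ (cr' F θ hP g₀ os).T K, (cr' F θ hP g₀ os).A K t τ) ∧
          (∀ (K : ℕ) (t : ℝ), |t| ≤ (cr' F θ hP g₀ os).l₀ →
            T4GenFunBounds.schemeZ ((datumOfRecord₁₃CoPH F 2 θ hP).scheme g₀) os ((cr' F θ hP g₀ os).K₀ + K + 1) t =
              ∑ τ ∈ (cr' F θ hP g₀ os).T K, (cr' F θ hP g₀ os).B K t τ))
    (h19' : ∀ (F : T4Family) (θ : Stage13HParams F 2) (hP : θ.Provisos₁₃CoPH F 2), ((θ.ZhUnity F 2 ∧ θ.SlotsNondegenerate₁₃ F 2) ∧ ¬ θ.ppSel = ppSelLiveOfRecord F 2 θ.ν θ.τ9 (EOfRecord₁₃ F 2 θ.toStage13Params) (wOfRecord₉ F 2 θ.toStage9Params)) → θ.Admissible F 2 → ∀ (g₀ : ℕ → ℝ) (os : List (ULoop F)),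
      (∀ k : ℕ, RatesHolderAt (datumOfRecord₁₃CoPH F 2 θ hP) (rateCarriersOfRecord₁₃CoPH 𝔯 F θ hP g₀ os k) β) → letI := (cr' F θ hP g₀ os).dec
        ∃ δ : ℕ → ℝ, NE7.Core (cr' F θ hP g₀ os).l₀ (cr' F θ hP g₀ os).vol (cr' F θ hP g₀ os).T (cr' F θ hP g₀ os).Bad
          (fun K t τ => (cr' F θ hP g₀ os).A K t τ - (cr' F θ hP g₀ os).shA K t τ) (fun K t τ => (cr' F θ hP g₀ os).B K t τ - (cr' F θ hP g₀ os).shB K t τ) δ ∧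
          Summable δ) :
    SpineGivenEndpointR13SepCoPH :=
  fun F θ hP hG hθ _ _ =>
    (spine_rec13CCoPHOn_iff_forall_guarded (fun F θ => θ.ZhUnity F 2 ∧ θ.SlotsNondegenerate₁₃ F 2)).mp
      (spine_rec13CCoPHOn_of_split (fun F θ => θ.ZhUnity F 2 ∧ θ.SlotsNondegenerate₁₃ F 2)
        (fun F (θ : Stage13HParams F 2) => θ.ppSel = ppSelLiveOfRecord F 2 θ.ν θ.τ9 (EOfRecord₁₃ F 2 θ.toStage13Params) (wOfRecord₉ F 2 θ.toStage9Params))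
        (spine_rec13CCoPHOn_live_of_kernels_pin_at_crOfRecord₁₃VAt_cut K₀ jc sh β 𝔯 ℓ (fun F θ => θ.ZhUnity F 2 ∧ θ.SlotsNondegenerate₁₃ F 2) hpin
          (fun F D g₀ os R hR => h14 F D g₀ os R (rRec₁₃CoPHOn_mono 𝔯 (fun _ _ h => h.1) hR))
          (fun F D g₀ os R hR => h15 F D g₀ os R (rRec₁₃CoPHOn_mono 𝔯 (fun _ _ h => h.1) hR))
          (fun F D g₀ os R hR => h16 F D g₀ os R (rRec₁₃CoPHOn_mono 𝔯 (fun _ _ h => h.1) hR))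
          (fun F θ hP hRg hθ => h18 F θ hP hRg.1 hθ) (fun F θ hP hRg hθ => h22 F θ hP hRg.1 hθ)
          (fun F θ hP hRg hθ => hs F θ hP hRg.1 hθ) (fun F θ hP hRg hθ => hκ F θ hP hRg.1 hθ) (fun F θ hP hRg hθ => hcr F θ hP hRg.1 hθ)
          (fun F θ hP hRg hθ => hdec F θ hP hRg.1 hθ) hζm h20 h21 h19)
        (spine_rec13CCoPHOn_holder_of_kernels_pin_bundled cr' β 𝔯
          (fun F θ => (θ.ZhUnity F 2 ∧ θ.SlotsNondegenerate₁₃ F 2) ∧ ¬ θ.ppSel = ppSelLiveOfRecord F 2 θ.ν θ.τ9 (EOfRecord₁₃ F 2 θ.toStage13Params) (wOfRecord₉ F 2 θ.toStage9Params)) ℓ hpin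
          (fun F D g₀ os R hR => h14 F D g₀ os R (rRec₁₃CoPHOn_mono 𝔯 (fun _ _ h => h.1) hR))
          (fun F D g₀ os R hR => h15 F D g₀ os R (rRec₁₃CoPHOn_mono 𝔯 (fun _ _ h => h.1) hR))
          (fun F D g₀ os R hR => h16 F D g₀ os R (rRec₁₃CoPHOn_mono 𝔯 (fun _ _ h => h.1) hR))
          (fun F θ hP hRg hθ => h18 F θ hP hRg.1 hθ) (fun F θ hP hRg hθ => h22 F θ hP hRg.1 hθ)
          (fun F θ hP hRg hθ => hs F θ hP hRg.1 hθ) (fun F θ hP hRg hθ => hκ F θ hP hRg.1 hθ) (fun F θ hP hRg hθ => hcr F θ hP hRg.1 hθ)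
          (fun F θ hP hRg hθ => hdec F θ hP hRg.1 hθ)
          ((s_N20_sRec₁₃CoPHOn_iff cr' _).mpr h20') (by
            rintro F D g₀ os S ⟨θ, hP, hRg, hθ, -, rfl⟩
            exact h21' F θ hP hRg hθ g₀ os)
          hx' h19'))
      F θ hP.toCore hG hθ

end Summit.QuantumFields.YangMills.Theorems.BalabanUVNodesN27SpineRecord
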